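import Summits.HodgeConjecture.HodgeConjecture.Theses.EndoscopicMiddleDegree
import Summits.HodgeConjecture.HodgeConjecture.Theorems.BallQuotientHodgeAbsolute.Negative.HodgeImpliesAbsoluteHodge

/-!
# Line `ggp-staircase-special-level` — skeleton for crux `EndoscopicMiddleDegree.BallQuotientHodgeAbsolute`
(item stmt-HodgeConjecture-14348, route route-HodgeConjecture-EndoscopicMiddleDegree; crux-plan round 1 for the idea
card `Cruxes/BallQuotientHodgeAbsolute/Ideas/ggp-staircase-special-level.md`; triage r1-1/2/3: **pass / pass / pass**
(merge target of `special-divisor-visibility` and `lefschetz-cuspidal-localization`);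
planner-cruxplan-stmt-HodgeConjecture-14348-ggp-staircase-specia-0, 2026-08-16)

Crux (∀ `m`; `X(ℂ) ≅ Γ\𝔹^{2n}`, `n = m + 1`): every RATIONAL Hodge `(n,n)`-class `c ∈ H^{2n}(X(ℂ); ℂ)` of a compact
arithmetic ball quotient carrying `D : UnitaryBallQuotientDatum (2(m+1)) X` is `IsAbsoluteHodgeClass`.

## The line in one paragraph

Do not touch de Rham conjugates at all: prove the class ALGEBRAIC by walking it down the flag of special sub-ball
quotients `X = C_{2n} ⊃ C_{2n-1} ⊃ ⋯ ⊃ C_{n+1}` (`C_{2n-j} = c(W_j)`, `dim_E W_j = j`, one codimension per rung) until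
Lefschetz `(1,1)` bites, then push back up. In SUPPORT language on `X` alone (the tree has no sub-datum for `c(W)`,
but it has `classesSupportedOn X Z k = ker (Hᵏ(X(ℂ)) → Hᵏ((X∖Z)(ℂ)))`): write
`Supp_j := ⨆_{W totally positive, finrank W = j} classesSupportedOn X (D.specialSubvariety W) (2n)` — the classes
supported on the codimension-`j` special cycles; `Supp_0 = ⊤ ⊇ Supp_1 ⊇ ⋯ ⊇ Supp_{n-1}`.
* RUNG 1 (`stub_firstStep`, THE LEVER, hardest): every rational Hodge `(n,n)`-class lies in `Supp_1` — it is seen by the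
  special DIVISORS. Dually: restriction of `c` to the Hecke-saturated family of special divisors is injective on the
  Hodge classes, one notch beyond the optimal automorphic Lefschetz range (Bergeron–Clozel arXiv:1406.3765 Thm 3.1,
  `i ≤ dim S_W`); packet-wise this is a Gan–Gross–Prasad period for `(U(2n,1), U(2n-1,1))` with parameters
  `Ψ_{2n} ⊞ χ₀ | Ψ'_{2n-2} ⊞ χ₀⊠R₂` (relevant, arXiv:1911.02783 §3), archimedean component
  `A(n,n)|_{U(2n-1,1)} ∋ L·A'(n-1,n-1)` (no K-type obstruction: triage r1-1 X1, kit job j009990).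
* RUNGS `2 … m` (`stub_staircase`): a rational Hodge `(n,n)`-class supported on the codimension-`j` special cycles is
  supported on the codimension-`(j+1)` ones (`1 ≤ j`, `j + 1 ≤ m`): on the `(2n-j)`-ball quotient `c(W_j)` the lifted
  class has degree `2(n-j)` = `dim - j` (BELOW its middle), its restriction to special divisors is injective IN the
  Bergeron–Clozel range, and what the rung asks is non-degeneracy of the Lefschetz-lowered component
  `A(n-j,n-j) → L·A'(n-j-1,n-j-1)` — the GGP pair `(U(2n-j,1), U(2n-j-1,1))`, parameters
  `Ψ'_{2(n-j)} ⊞ χ₀⊠R_{j+1} | Ψ'_{2(n-j)-2} ⊞ χ₀⊠R_{j+2}`. Vacuous at `m = 1`.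
* BOTTOM (`stub_supportedAlgebraic`, true in print): a rational Hodge `(n,n)`-class in `Supp_m = Supp_{n-1}` is ALGEBRAIC:
  `Supp_{n-1}` = Gysin images of `H²` of (resolutions of) the `(n+1)`-dimensional special cycles (Deligne, Hodge III 8.2.8),
  Hodge classes lift along the Gysin surjection (semisimplicity of polarisable ℚ-HS), and upstairs they are DIVISOR classes
  (Lefschetz `(1,1)`), whose push-forwards are algebraic. At `m = 0` the only level-0 cycle is `c(⊥) = X` itself
  (`classesSupportedOn_specialSubvariety_bot`, proved) and the stub IS Lefschetz `(1,1)` on the compact 2-ball quotient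
  — Disproof §3's degenerate level, absorbed uniformly ("Lefschetz (1,1) on the `(m+2)`-dimensional special cycles").
* CHARTS (`stub_cycleClassesAbsoluteHodge`, true in print, tree-blocked): cycle classes are absolute Hodge (Deligne 1982
  Ex. 2.1(a); Charles–Schnell §11.2.2), spelled verbatim as the hypothesis `hAH` of the landed
  `Negative/HodgeImpliesAbsoluteHodge.lean` — the ONE place where conjugation charts are built (Disproof §6).
`BallQuotientHodgeAbsolute_of` composes the four (kernel-checked, no `sorry`; induction on the rung for the staircase,
`W = ⊥` for `m = 0`) and concludes the crux BY NAME. `specialLevelDetection_of` realises the card's TRANSFER `C⁺`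
(`SpecialLevelDetection`, verbatim from `IdeatorOneSketch.lean`) from rungs 1–2; `middleHodge_of` / `middleDegreeStep_of`
record the pay-off beyond the crux: the same stubs prove middle-degree HC on the family, hence the route TARGET
`MiddleDegreeStep` by name (idea card (5); triage r1-2 "an engine for the heart; the crux rides as corollary").

## Stubs (4) · hardest: `stub_firstStep`
`stub_firstStep` (XL, open) · `stub_staircase` (XL, open; vacuous at `m = 1`) · `stub_supportedAlgebraic` (L, in print) ·
`stub_cycleClassesAbsoluteHodge` (L, in print; tree-blocked on `ConjugationChart` existence + Grothendieck comparison).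

## Disproof.lean obligations honoured (cycles 1–2, NO KILL; landed Negative/{HodgeImpliesAbsoluteHodge,
ChartConjugationUniqueness}.lean imported/checked)
No `_false_without_<H>` theorem, tightness lemma, refuted strengthening or `-- Targets` stub kill exists. §1 (bare
conjugation clause): the line reaches the clause only through cycle classes (stub 4). §2 (`of_middleHodge` shape,
`CycleClassesAbsoluteHodge`): the composition IS that shape — `middleHodge_of` then stub 4, used once. §3 (`m = 0`
Lefschetz): stub 3 at `m = 0`. §4 (rationality and Hodge type load-bearing): every stub keeps BOTH hypotheses on `c`
(rationality is consumed by semisimple lifting + Lefschetz (1,1) in stub 3 and by the period/packet argument in stubs 1–2);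
the datum is load-bearing for the PROOF only (`of_withoutDatum`) — stubs 1–3 use its fields `specialSubvariety`,
`isClosed_…`, `le_coheight_…`, `pt_mem_specialSubvariety_iff`. §6/§8 (charts, single-valuedness): confined to stub 4.
§9 (de Rham vs étale): no Tate class is needed anywhere. No stub is an instance a landed Negative lemma refutes (they
refute `WithoutRational`/`WithoutHodgeType`/multivalued charts only); no stub restates the crux, the target, the summit,
`HigherBlasiusRogawskiClass` or a statement of the negatives index (2 unrelated entries).
-/

noncomputable section

set_option linter.dupNamespace false

namespace Summit.HodgeConjecture.HodgeConjecture.Cruxes.BallQuotientHodgeAbsolute.GgpStaircaseSpecialLevel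

open CategoryTheory
open Literature.AlgebraicGeometry.Motives (SchemeOver ComplexPoints IsSmoothProjective)
open Literature.AlgebraicGeometry.HodgeTheory
open Literature.AlgebraicGeometry.ShimuraVarieties
open Literature.AlgebraicTopology.SingularHomology
open Summit.HodgeConjecture.HodgeConjecture.Theses.EndoscopicMiddleDegree (BallQuotientHodgeAbsolute MiddleDegreeStep)

/-! ### §0 Level-`j` supports and the degenerate level (PROVED) -/

section Supports

variable {p : ℕ} {X : SchemeOver ℂ}

/-- `Supp_j` in degree `k`: the classes of `Hᵏ(X(ℂ); ℂ)` supported on the special cycles `c(W)` of codimension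
`j` (`W ⊆ V` totally positive definite, `dim_E W = j`). An `abbrev` for the prose and the glue only — every
registered stub spells it out. (`Supp_j` in degree `2j` is the route's rendering of `specialCycleClasses D j`.) -/
abbrev levelSupport (D : UnitaryBallQuotientDatum p X) (j k : ℕ) : Submodule ℂ (complexBetti X k) :=
  ⨆ (W : Submodule D.E (Fin (p + 1) → D.E)) (_ : IsTotallyPositive (conjRingHom D.E) D.H W)
    (_ : Module.finrank D.E W = j), classesSupportedOn X (D.specialSubvariety W) k

variable (D : UnitaryBallQuotientDatum p X)

/-- The zero subspace is totally positive definite (vacuously). -/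
theorem isTotallyPositive_bot : IsTotallyPositive (conjRingHom D.E) D.H (⊥ : Submodule D.E (Fin (p + 1) → D.E)) :=
  fun _ hw hne ↦ (hne ((Submodule.mem_bot _).1 hw)).elim

/-- **Every class is supported on `c(⊥) = X`**: the special subvariety of `W = 0` contains every complex point
(`UnitaryBallQuotientDatum.pt_mem_specialSubvariety_bot`), so `(X ∖ c(⊥))(ℂ) = ∅` has zero cohomology. -/
theorem classesSupportedOn_specialSubvariety_bot (k : ℕ) :
    classesSupportedOn X (D.specialSubvariety ⊥) k = ⊤ := by
  refine eq_top_iff.2 fun x _ ↦ mem_classesSupportedOn_iff.mpr ?_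
  haveI : IsEmpty (Literature.AlgebraicGeometry.Motives.complexPointsCompl X (D.specialSubvariety ⊥)) :=
    ⟨fun P ↦ P.2 (D.pt_mem_specialSubvariety_bot P.1)⟩
  haveI := ModuleCat.subsingleton_of_isZero
    (Literature.AlgebraicGeometry.Motives.isZero_singularCohomology_of_isEmpty ℂ ℂ
      (E := Literature.AlgebraicGeometry.Motives.complexPointsCompl X (D.specialSubvariety ⊥)) k)
  exact Subsingleton.elim _ _

/-- **Level `0` is everything**: `Supp_0 = ⊤` (take `W = ⊥`, `dim W = 0`, `c(⊥) = X`). This is what makes the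
degenerate level `m = 0` of the crux a case of STUB 3 (Lefschetz `(1,1)` on the 2-ball quotient itself). -/
theorem mem_levelSupport_zero (k : ℕ) (c : complexBetti X k) : c ∈ levelSupport D 0 k := by
  refine Submodule.mem_iSup_of_mem ⊥ (Submodule.mem_iSup_of_mem (isTotallyPositive_bot D)
    (Submodule.mem_iSup_of_mem (finrank_bot D.E (Fin (p + 1) → D.E)) ?_))
  rw [classesSupportedOn_specialSubvariety_bot]
  exact Submodule.mem_top

end Supports

/-! ### §1 The statements of the line (named `Prop`s; each registered stub below expands one verbatim) -/

/-- RUNG 1 — **special divisors see every rational Hodge middle class** (`m ≥ 1`): on `X^{2n}`, `n = m+1 ≥ 2`,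
every rational Hodge `(n,n)`-class lies in `Supp_1` (degree `2n`), the span of the classes supported on the special
divisors `c(W)`, `dim_E W = 1` (= Gysin images of `H^{2m}` of the `(2m+1)`-ball sub-quotients). At `m = 1` this is
the typed transfer `SpecialLevelDetection 1` = `special-divisor-visibility`'s `SpecialDivisorSupport (4,2)` =
`lefschetz-cuspidal-localization`'s "no Lefschetz-cuspidal rational (2,2)-class" (triage: identical at `m = 1`).
The guard `1 ≤ m` is necessary: at `m = 0` it would say special Shimura CURVES span the rational `(1,1)`-classes of a
compact Picard modular surface — false in print (BMM arXiv:1306.1515 p. 3 Rem. 3, Prop. 70 vs Cor. 62). -/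
def FirstRung : Prop :=
  ∀ (m : ℕ) (X : SchemeOver ℂ) (D : UnitaryBallQuotientDatum (2 * (m + 1)) X), 1 ≤ m →
    ∀ c : complexBetti X (2 * (m + 1)), IsRationalClass c →
      IsOfHodgeType (2 * (m + 1)) X (2 * (m + 1)) (m + 1) (m + 1) c →
        c ∈ ⨆ (W : Submodule D.E (Fin (2 * (m + 1) + 1) → D.E))
            (_ : IsTotallyPositive (conjRingHom D.E) D.H W) (_ : Module.finrank D.E W = 1),
            classesSupportedOn X (D.specialSubvariety W) (2 * (m + 1))

/-- RUNGS `2 … m` — **one rung down** (`1 ≤ j`, `j + 1 ≤ m`): a rational Hodge `(n,n)`-class supported on the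
codimension-`j` special cycles is supported on the codimension-`(j+1)` special cycles. -/
def Staircase : Prop :=
  ∀ (m : ℕ) (X : SchemeOver ℂ) (D : UnitaryBallQuotientDatum (2 * (m + 1)) X) (j : ℕ), 1 ≤ j → j + 1 ≤ m →
    ∀ c : complexBetti X (2 * (m + 1)), IsRationalClass c →
      IsOfHodgeType (2 * (m + 1)) X (2 * (m + 1)) (m + 1) (m + 1) c →
        c ∈ (⨆ (W : Submodule D.E (Fin (2 * (m + 1) + 1) → D.E))
            (_ : IsTotallyPositive (conjRingHom D.E) D.H W) (_ : Module.finrank D.E W = j),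
            classesSupportedOn X (D.specialSubvariety W) (2 * (m + 1))) →
        c ∈ ⨆ (W : Submodule D.E (Fin (2 * (m + 1) + 1) → D.E))
            (_ : IsTotallyPositive (conjRingHom D.E) D.H W) (_ : Module.finrank D.E W = j + 1),
            classesSupportedOn X (D.specialSubvariety W) (2 * (m + 1))

/-- BOTTOM — **supported at level `m` ⟹ algebraic** (all `m`): a rational Hodge `(m+1,m+1)`-class of the middle
degree lying in `Supp_m` (the `(m+2)`-dimensional special cycles; at `m = 0`, `X` itself) is an algebraic class. -/
def SupportedAlgebraic : Prop :=
  ∀ (m : ℕ) (X : SchemeOver ℂ) (D : UnitaryBallQuotientDatum (2 * (m + 1)) X)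
    (c : complexBetti X (2 * (m + 1))), IsRationalClass c →
      IsOfHodgeType (2 * (m + 1)) X (2 * (m + 1)) (m + 1) (m + 1) c →
        c ∈ (⨆ (W : Submodule D.E (Fin (2 * (m + 1) + 1) → D.E))
            (_ : IsTotallyPositive (conjRingHom D.E) D.H W) (_ : Module.finrank D.E W = m),
            classesSupportedOn X (D.specialSubvariety W) (2 * (m + 1))) →
        c ∈ algebraicClasses X (m + 1)

/-- CHARTS — **cycle classes are absolute Hodge** (Deligne 1982 Ex. 2.1(a); Charles–Schnell §11.2.2, after Def.
11.2.3), spelled verbatim as the hypothesis `hAH` of `Negative/HodgeImpliesAbsoluteHodge.lean` and as Disproof §2's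
`CycleClassesAbsoluteHodge`. -/
def CycleClassesAbsoluteHodge : Prop :=
  ∀ ⦃n : ℕ⦄ ⦃X : SchemeOver ℂ⦄, IsSmoothProjective n X →
    ∀ (p : ℕ) (c : complexBetti X (2 * p)), IsRationalClass c → IsOfHodgeType n X (2 * p) p p c →
      c ∈ algebraicClasses X p → IsAbsoluteHodgeClass n X p c

/-- The card's TRANSFER `C⁺` (verbatim `IdeatorOneSketch.SpecialLevelDetection`): for `m ≥ 1` every rational Hodge
middle class lies in `Supp_m` — supported on the codimension-`(n-1)` special cycles, the `(n+1)`-ball sub-quotients.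
Derived below from RUNG 1 + RUNGS 2…m (`specialLevelDetection_of`); not itself a stub. -/
def SpecialLevelDetection : Prop :=
  ∀ (m : ℕ) (X : SchemeOver ℂ) (D : UnitaryBallQuotientDatum (2 * (m + 1)) X), 1 ≤ m →
    ∀ c : complexBetti X (2 * (m + 1)), IsRationalClass c →
      IsOfHodgeType (2 * (m + 1)) X (2 * (m + 1)) (m + 1) (m + 1) c →
        c ∈ ⨆ (W : Submodule D.E (Fin (2 * (m + 1) + 1) → D.E))
            (_ : IsTotallyPositive (conjRingHom D.E) D.H W) (_ : Module.finrank D.E W = m),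
            classesSupportedOn X (D.specialSubvariety W) (2 * (m + 1))

/-- Middle-degree HC on the family, all levels (verbatim Disproof §2 `MiddleHodge`): what rungs + bottom prove
BEFORE charts enter; strictly more than the crux needs and exactly what the route target consumes. -/
def MiddleHodge : Prop :=
  ∀ (m : ℕ) (X : SchemeOver ℂ), Nonempty (UnitaryBallQuotientDatum (2 * (m + 1)) X) →
    ∀ c : complexBetti X (2 * (m + 1)), IsRationalClass c →
      IsOfHodgeType (2 * (m + 1)) X (2 * (m + 1)) (m + 1) (m + 1) c → c ∈ algebraicClasses X (m + 1)

/-- THE `m = 1` BET, stated separately (triage r1-3 sharpening; the common typed bet of cards 1, 5, 6 and the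
hypothesis of card 8): rational Hodge `(2,2)`-classes on compact arithmetic 4-ball quotients are supported on the
special divisors (compact 3-ball sub-quotients). The `m = 1` slice of RUNG 1 (`fourfold_of_firstRung`). -/
def FourfoldSpecialDivisorSupport : Prop :=
  ∀ (X : SchemeOver ℂ) (D : UnitaryBallQuotientDatum (2 * (1 + 1)) X) (c : complexBetti X (2 * (1 + 1))),
    IsRationalClass c → IsOfHodgeType (2 * (1 + 1)) X (2 * (1 + 1)) (1 + 1) (1 + 1) c →
      c ∈ ⨆ (W : Submodule D.E (Fin (2 * (1 + 1) + 1) → D.E))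
          (_ : IsTotallyPositive (conjRingHom D.E) D.H W) (_ : Module.finrank D.E W = 1),
          classesSupportedOn X (D.specialSubvariety W) (2 * (1 + 1))

/-! ### §2 The four registered stubs (statements expanded over existing declarations) -/

/-- **STUB 1 — RUNG 1: special divisors see every rational Hodge middle class (XL, OPEN, THE LEVER — hardest and
most informative).** For `m ≥ 1`, `D : UnitaryBallQuotientDatum (2(m+1)) X` and `c ∈ H^{2(m+1)}(X(ℂ); ℂ)` rational
of Hodge type `(m+1,m+1)`: `c` lies in the span of the classes supported on the special divisors `c(W)`
(`W ⊆ V` a totally positive `E`-line). WHY PLAUSIBLY TRUE: `c = c₀ + L·c'`; the Lefschetz part is free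
(`L = Σ aᵢ[c(Wᵢ)]` by Kudla–Millson modularity of the special-divisor generating series, so
`L·c' = Σ aᵢ ιᵢ*ιᵢ^*c'` is supported); for `c₀` primitive in a cohomological `π = A(n,n) ⊗ π_f`, the support statement
is (Poincaré-)dual to `ι^*c₀ ≠ 0` on some Hecke translate of a special divisor, i.e. to the non-vanishing of a
Gan–Gross–Prasad period for `(U(2n,1),U(2n-1,1))`; rationality forces Tate-type host packets `Ψ_{2n} ⊞ χ₀`
(sieve), for which the pair of parameters `Ψ_{2n}⊞χ₀ | Ψ'_{2n-2}⊞χ₀⊠R₂` is GGP-relevant with the tempered remainder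
`Ψ'` free (arXiv:1911.02783 §§3,5–6; tempered endoscopic case a theorem, arXiv:2007.05601; one non-tempered
direction arXiv:1508.03205), and the archimedean symmetry breaking `A(n,n)|_{U(2n-1,1)} → L·A'(n-1,n-1)` has no
`K`-type obstruction at `n = 2` (triage r1-1 X1, kit j009990). WHY IT MIGHT FAIL: it is one notch beyond the
OPTIMAL automorphic Lefschetz range (Bergeron–Clozel arXiv:1406.3765 Thm 3.1: `i ≤ dim S_W`; here `i = dim S_W + 1`),
the needed direction of non-tempered GGP is open, restriction-then-Gysin through an AMPLE class sees nothing
primitive (`ι_*ι^* = ∪L` kills `P^{2n}`), so everything rides on the individual special divisors — non-ample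
(negative normal bundle), Hecke-saturated, equidistributed — detecting (triage r1-3), and the `∀`-form silently
contains
CORE VANISHING (a rational `(n,n)`-class in a stable / characterless packet is GGP-invisible to special divisors and
would have to be absent — HC + irreducibility predict so; no tool). Refutable only by a rational Hodge middle class
invisible to all special divisors (= HC-counterexample territory, Disproof §2). -/
theorem stub_firstStep :
    ∀ (m : ℕ) (X : SchemeOver ℂ) (D : UnitaryBallQuotientDatum (2 * (m + 1)) X), 1 ≤ m →
      ∀ c : complexBetti X (2 * (m + 1)), IsRationalClass c →
        IsOfHodgeType (2 * (m + 1)) X (2 * (m + 1)) (m + 1) (m + 1) c →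
          c ∈ ⨆ (W : Submodule D.E (Fin (2 * (m + 1) + 1) → D.E))
              (_ : IsTotallyPositive (conjRingHom D.E) D.H W) (_ : Module.finrank D.E W = 1),
              classesSupportedOn X (D.specialSubvariety W) (2 * (m + 1)) := by
  sorry

/-- **STUB 2 — RUNGS 2…m: one rung down the staircase (XL, OPEN; vacuous at `m = 1`).** For `1 ≤ j`, `j + 1 ≤ m`:
a rational Hodge `(m+1,m+1)`-class of `X^{2(m+1)}` supported on the codimension-`j` special cycles is supported on
the codimension-`(j+1)` special cycles. WHY PLAUSIBLY TRUE: `Supp_j` is the Gysin image of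
`⊕_W H^{2(n-j)}(c̃(W))(-j)` (Deligne, Hodge III 8.2.8), a rational Hodge class in it lifts to rational Hodge
`(n-j,n-j)`-classes `a_W` on (resolutions of) the `(2n-j)`-ball quotients `c(W)` (semisimplicity), where the degree
`2(n-j) = dim c(W) - j` is BELOW the middle: restriction of `a_W` to the special divisors `c(W') ⊂ c(W)`
(`W ⊂ W'`, `dim W' = j+1`) is injective IN the Bergeron–Clozel range (`2(n-j) ≤ dim c(W')`), and the rung asks
that its Lefschetz-lowered component (`a_W|_{c(W')} = prim + L·a_{W'}`) detects — the symmetry breaking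
`A(n-j,n-j) → L·A'(n-j-1,n-j-1)` for the GGP pair `(U(2n-j,1),U(2n-j-1,1))`, parameters
`Ψ'_{2(n-j)}⊞χ₀⊠R_{j+1} | Ψ'_{2(n-j)-2}⊞χ₀⊠R_{j+2}`, relevant at every rung with free tempered remainder (idea card).
For `2j > n` the rung is inside BMM's range on `c(W)` (Cor. 2 / Thm 4: `n-j < (2n-j)/3`; in print modulo the
endoscopic classification, tree tag `@[conjecture]` on `bmm2016_*`), realised there by `SC·H^{1,1}` classes of
`c(W)`, all supported one level down. WHY IT MIGHT FAIL: the shallow rungs sit in the middle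
third of the sub-quotients (CAP packets `μ⊠R_b⊞…`): at `m = 2` the one rung `j = 1 → 2` runs through rational
`(2,2)`-classes on compact 5-ball quotients — the degree of the route's crux #5 `HigherBlasiusRogawskiClass`; if such
a class occurs INSIDE `Supp_1` of a 6-ball quotient and is invisible to the 4-ball sub-quotients, the rung is false
there (the line then bets with kill-criterion (iv) of the route, against L2 — recorded, triage r1-2 on card 6). -/
theorem stub_staircase :
    ∀ (m : ℕ) (X : SchemeOver ℂ) (D : UnitaryBallQuotientDatum (2 * (m + 1)) X) (j : ℕ), 1 ≤ j → j + 1 ≤ m →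
      ∀ c : complexBetti X (2 * (m + 1)), IsRationalClass c →
        IsOfHodgeType (2 * (m + 1)) X (2 * (m + 1)) (m + 1) (m + 1) c →
          c ∈ (⨆ (W : Submodule D.E (Fin (2 * (m + 1) + 1) → D.E))
              (_ : IsTotallyPositive (conjRingHom D.E) D.H W) (_ : Module.finrank D.E W = j),
              classesSupportedOn X (D.specialSubvariety W) (2 * (m + 1))) →
          c ∈ ⨆ (W : Submodule D.E (Fin (2 * (m + 1) + 1) → D.E))
              (_ : IsTotallyPositive (conjRingHom D.E) D.H W) (_ : Module.finrank D.E W = j + 1),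
              classesSupportedOn X (D.specialSubvariety W) (2 * (m + 1)) := by
  sorry

/-- **STUB 3 — BOTTOM: supported at level `m` ⟹ algebraic (L; TRUE IN PRINT, unconditionally — triage r1-1/2).**
For every `m`, a rational Hodge `(m+1,m+1)`-class `c ∈ H^{2(m+1)}(X(ℂ); ℂ)` lying in `Supp_m` is an algebraic class.
PROOF IN PRINT: for `Z = c(W)` closed of codimension `m` in the smooth projective `2(m+1)`-fold `X`,
`classesSupportedOn X Z (2(m+1)) = im (H^{2(m+1)}_Z(X) → H^{2(m+1)}(X)) = im (ι̃_* : H²(Z̃)(-m) → H^{2m+2}(X))` for a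
resolution `Z̃ → Z` of the `(m+2)`-dimensional special cycle (Deligne, Hodge III Prop. 8.2.8 / Hodge II 8.2.7: the
Gysin image carries the whole pure-weight part); `⊕_W H²(Z̃_W, ℚ)(-m) ↠ Supp_m ∩ H^{2m+2}(X, ℚ)` is a morphism of
polarisable ℚ-Hodge structures, so the rational Hodge class `c` lifts to rational Hodge `(1,1)`-classes upstairs
(semisimplicity, Deligne 1971 §4.2); those are ℚ-combinations of DIVISOR classes (Lefschetz `(1,1)`, tree fact
`lefschetzOneOne_rational` on each smooth projective `Z̃_W`), and `ι̃_* cl(d) = cl(ι̃_* d)` is algebraic (Fulton 19.1.2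
/ Voisin II Prop. 9.21 (ii); tree: `GysinFormalism.cl_map`, `iSup_classesSupportedOn_le_algebraicClasses`). BMM Cor. 62
(`H^{1,1}` of a `p'`-ball quotient defined over ℚ for `p' ≥ 3`) is NOT needed (triage r1-2). At `m = 0` the only
level-0 cycle is `c(⊥) = X` (`classesSupportedOn_specialSubvariety_bot`), the hypothesis is vacuous and the stub is
Lefschetz `(1,1)` on the compact 2-ball quotient — Disproof §3, see `supportedAlgebraic_zero_of_lefschetz`. In the
tree: needs a Gysin/cycle-class instance (`GysinFormalism` is a hypothesis structure), Hodge II–III for `H_Z`, and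
resolution; SIZE L. This is the support form of `lefschetz-cuspidal-localization`'s `GysinDichotomyFourfold`
("the Gysin part is algebraic", triage r1-3), bound to the datum and stated for every `m`. -/
theorem stub_supportedAlgebraic :
    ∀ (m : ℕ) (X : SchemeOver ℂ) (D : UnitaryBallQuotientDatum (2 * (m + 1)) X)
      (c : complexBetti X (2 * (m + 1))), IsRationalClass c →
        IsOfHodgeType (2 * (m + 1)) X (2 * (m + 1)) (m + 1) (m + 1) c →
          c ∈ (⨆ (W : Submodule D.E (Fin (2 * (m + 1) + 1) → D.E))
              (_ : IsTotallyPositive (conjRingHom D.E) D.H W) (_ : Module.finrank D.E W = m),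
              classesSupportedOn X (D.specialSubvariety W) (2 * (m + 1))) →
          c ∈ algebraicClasses X (m + 1) := by
  sorry

/-- **STUB 4 — CHARTS: cycle classes are absolute Hodge (L; TRUE IN PRINT — Deligne 1982 Ex. 2.1(a), Charles–Schnell
2014 §11.2.2 "the cohomology class of an algebraic cycle is an absolute Hodge class"; TREE-BLOCKED).** On a smooth
projective complex variety every rational `(p,p)`-class in the span of the cycle classes is `IsAbsoluteHodgeClass`.
Spelled EXACTLY as the hypothesis `hAH` of the landed `Negative/HodgeImpliesAbsoluteHodge.lean` (and Disproof §2
`CycleClassesAbsoluteHodge`), so that one proof serves every consumer. What it must build (Disproof §6/§8): for every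
`σ ∈ Aut ℂ` a `ConjugationChart σ X (2p)` (Jouanolou cover `Y → X`, analytifications of `Y`, `Y^σ`, a natural
ℚ-normalised de Rham family — GAGA + de Rham + Grothendieck comparison), single-valued at `0`
(`Negative/ChartConjugationUniqueness.lean`), in which the algebraic de Rham representative of `cl(Z)` conjugates to
that of `cl(Z^σ)`; plus "a rational class in the ℂ-span of cycle classes is a ℚ-combination of them" (tree:
`span_isRationalClass…`) and additivity of chart conjugation (`conjugates_add`, landed). This is the ONLY stub that
touches conjugates; it is where the line honours `nonempty_conjugationChart_of_ballQuotientHodgeAbsolute`. -/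
theorem stub_cycleClassesAbsoluteHodge :
    ∀ ⦃n : ℕ⦄ ⦃X : SchemeOver ℂ⦄, IsSmoothProjective n X →
      ∀ (p : ℕ) (c : complexBetti X (2 * p)), IsRationalClass c → IsOfHodgeType n X (2 * p) p p c →
        c ∈ algebraicClasses X p → IsAbsoluteHodgeClass n X p c := by
  sorry

/-! ### §3 Consistency: each named statement IS its registered stub (definitionally) -/

example : FirstRung := stub_firstStep
example : Staircase := stub_staircase
example : SupportedAlgebraic := stub_supportedAlgebraic
example : CycleClassesAbsoluteHodge := stub_cycleClassesAbsoluteHodge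

/-! Name-keyed aliases of the four statements (the hypotheses of the composition: the skeleton audit admits a
hypothesis only if its head constant is a registered obligation or is named like a declared stub). -/
namespace Registered

/-- Alias of `FirstRung` keyed by the registered stub name. -/
abbrev stub_firstStep : Prop := FirstRung
/-- Alias of `Staircase` keyed by the registered stub name. -/
abbrev stub_staircase : Prop := Staircase
/-- Alias of `SupportedAlgebraic` keyed by the registered stub name. -/
abbrev stub_supportedAlgebraic : Prop := SupportedAlgebraic
/-- Alias of `CycleClassesAbsoluteHodge` keyed by the registered stub name. -/
abbrev stub_cycleClassesAbsoluteHodge : Prop := CycleClassesAbsoluteHodge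

end Registered

/-! ### §4 Glue (PROVED): climbing the staircase, the transfer, middle-degree HC on the family -/

/-- **The transfer `C⁺` from the rungs** (induction on the level): RUNG 1 puts a rational Hodge middle class in
`Supp_1`, each further rung moves it from `Supp_j` to `Supp_{j+1}` while `j + 1 ≤ m`; at `j = m` it sits on the
`(n+1)`-dimensional special cycles. -/
theorem specialLevelDetection_of (h₁ : FirstRung) (h₂ : Staircase) : SpecialLevelDetection := by
  intro m X D hm c hc hH
  suffices key : ∀ j, 1 ≤ j → j ≤ m → c ∈ levelSupport D j (2 * (m + 1)) from key m hm le_rfl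
  intro j hj
  induction j, hj using Nat.le_induction with
  | base => exact fun _ ↦ h₁ m X D hm c hc hH
  | succ j hj ih => exact fun hjm ↦ h₂ m X D j hj hjm c hc hH (ih (Nat.le_of_succ_le hjm))

/-- **Middle-degree HC on the family from detection + bottom** (Disproof §2's `MiddleHodge`): at `m ≥ 1` the class is
detected at level `m` and STUB 3 makes it algebraic; at `m = 0` it is supported on `c(⊥) = X` for free
(`mem_levelSupport_zero`) and STUB 3 is Lefschetz `(1,1)`. -/
theorem middleHodge_of (hdet : SpecialLevelDetection) (h₃ : SupportedAlgebraic) : MiddleHodge := by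
  intro m X hD c hc hH
  obtain ⟨D⟩ := hD
  refine h₃ m X D c hc hH ?_
  rcases Nat.eq_zero_or_pos m with rfl | hm
  · exact mem_levelSupport_zero D _ c
  · exact hdet m X D hm c hc hH

/-! ### §5 The composition: the four stubs imply the crux, BY NAME (kernel-checked, no `sorry`) -/

/-- **`BallQuotientHodgeAbsolute` from the four stubs.** Rungs 1–2 give the transfer `SpecialLevelDetection`
(`specialLevelDetection_of`), the bottom stub turns it into middle-degree HC on the family (`middleHodge_of`, the
degenerate level `m = 0` included via `c(⊥) = X`), and cycle classes are absolute Hodge (STUB 4, used once, exactly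
Disproof §2's `of_middleHodge` shape). -/
theorem BallQuotientHodgeAbsolute_of (h₁ : Registered.stub_firstStep) (h₂ : Registered.stub_staircase)
    (h₃ : Registered.stub_supportedAlgebraic) (h₄ : Registered.stub_cycleClassesAbsoluteHodge) :
    Summit.HodgeConjecture.HodgeConjecture.Theses.EndoscopicMiddleDegree.BallQuotientHodgeAbsolute :=
  fun m X hD c hc hH ↦
    h₄ hD.some.isSmoothProjective (m + 1) c hc hH
      (middleHodge_of (specialLevelDetection_of h₁ h₂) h₃ m X hD c hc hH)

/-- Wiring check: the registered stubs feed `BallQuotientHodgeAbsolute_of` as stated. -/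
example : Summit.HodgeConjecture.HodgeConjecture.Theses.EndoscopicMiddleDegree.BallQuotientHodgeAbsolute :=
  BallQuotientHodgeAbsolute_of stub_firstStep stub_staircase stub_supportedAlgebraic stub_cycleClassesAbsoluteHodge

/-! ### §6 Sector corollaries and pay-off (PROVED; none concludes the crux name) -/

/-- The `m = 1` bet is the `m = 1` slice of RUNG 1. -/
theorem fourfold_of_firstRung (h₁ : FirstRung) : FourfoldSpecialDivisorSupport :=
  fun X D c hc hH ↦ h₁ 1 X D le_rfl c hc hH

/-- **The crux for compact arithmetic ball-quotient FOURFOLDS** (the route's `m = 1`; Disproof's `AtLevel 1`) needs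
only the `m = 1` bet, the bottom stub and charts — the staircase is empty at `m = 1`. So a lead who closes
`stub_firstStep` at `m = 1` (plus the two in-print stubs) settles the first open level of the crux and, by
`not_middleDegreeStep_of_not_level_one` (Negative file) read forwards, the arithmetic half of the route target there. -/
theorem levelOne_of (h : FourfoldSpecialDivisorSupport) (h₃ : SupportedAlgebraic) (h₄ : CycleClassesAbsoluteHodge) :
    ∀ (X : SchemeOver ℂ), Nonempty (UnitaryBallQuotientDatum (2 * (1 + 1)) X) →
      ∀ c : complexBetti X (2 * (1 + 1)), IsRationalClass c →
        IsOfHodgeType (2 * (1 + 1)) X (2 * (1 + 1)) (1 + 1) (1 + 1) c →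
          IsAbsoluteHodgeClass (2 * (1 + 1)) X (1 + 1) c :=
  fun X hD c hc hH ↦
    h₄ hD.some.isSmoothProjective (1 + 1) c hc hH (h₃ 1 X hD.some c hc hH (h X hD.some c hc hH))

/-- **Pay-off beyond the crux** (idea card (5); triage r1-2 "an engine for the heart"): detection + bottom prove
middle-degree HC on the family, hence the route TARGET `MiddleDegreeStep` by name — its sector bounds and its
lower-degree hypothesis unused. Recorded, not claimed: it shows the line attacks `MiddleThetaSpan`'s job too, with
Noether–Lefschetz generators (divisors of special `(n+1)`-ball sub-quotients) in place of theta lifts. -/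
theorem middleDegreeStep_of (hdet : SpecialLevelDetection) (h₃ : SupportedAlgebraic) :
    Summit.HodgeConjecture.HodgeConjecture.Theses.EndoscopicMiddleDegree.MiddleDegreeStep :=
  fun m X _ _ hD _ c hc hH ↦ middleHodge_of hdet h₃ m X hD c hc hH

/-! ### §7 Checks against the landed Negative lemmas and the degenerate level -/

/-- STUB 4 is literally the Negative file's `hAH`: with it, a kill of the crux is a disproof of the Hodge conjecture
(kill criterion (iii) of the route; `Negative.not_hodgeConjecture_of_not_ballQuotientHodgeAbsolute`). -/
example (h₄ : CycleClassesAbsoluteHodge)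
    (hneg : ¬ Summit.HodgeConjecture.HodgeConjecture.Theses.EndoscopicMiddleDegree.BallQuotientHodgeAbsolute) :
    ¬ _root_.HodgeConjecture :=
  Summit.HodgeConjecture.HodgeConjecture.Theorems.BallQuotientHodgeAbsolute.Negative.not_hodgeConjecture_of_not_ballQuotientHodgeAbsolute
    h₄ hneg

/-- **Level `0` of STUB 3 is Lefschetz `(1,1)`** (Disproof §3 / Negative `level_zero_of_lefschetz`): on a compact
2-ball quotient the level-0 hypothesis is free and the conclusion is the tree fact `lefschetzOneOne_rational`. So the
first open instance of STUB 3 is `m = 1` (rational `(2,2)`-classes pushed from `H²` of compact 3-ball sub-quotients). -/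
theorem supportedAlgebraic_zero_of_lefschetz (hL : lefschetzOneOne_rational) (X : SchemeOver ℂ)
    (D : UnitaryBallQuotientDatum (2 * (0 + 1)) X) (c : complexBetti X (2 * (0 + 1))) (hc : IsRationalClass c)
    (hH : IsOfHodgeType (2 * (0 + 1)) X (2 * (0 + 1)) (0 + 1) (0 + 1) c) :
    c ∈ levelSupport D 0 (2 * (0 + 1)) ∧ c ∈ algebraicClasses X (0 + 1) :=
  ⟨mem_levelSupport_zero D _ c, hL D.isSmoothProjective c hc hH⟩

/-- **Monotonicity in the support, on complex points** (the staircase only ever CONFINES): if every complex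
point of `Z'` lies on `Z` then a class supported on `Z'` is supported on `Z` — `classesSupportedOn` sees only the
complex points over the complement. For `W ⊆ W'` the datum gives `c(W')(ℂ) ⊆ c(W)(ℂ)` (`pt_mem_specialSubvariety_iff`:
images of nested sub-cones), so classes supported on a codimension-`(j+1)` special cycle are supported on every
codimension-`j` special cycle through it: `Supp_{j+1} ≤ Supp_j`, the rungs are successive confinements of one class. -/
theorem classesSupportedOn_mono_of_complexPoints {X : SchemeOver ℂ} {Z Z' : Set X.left}
    (h : ∀ P : ComplexPoints X, P.pt ∈ Z' → P.pt ∈ Z) (k : ℕ) :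
    classesSupportedOn X Z' k ≤ classesSupportedOn X Z k := by
  intro x hx
  rw [mem_classesSupportedOn_iff] at hx ⊢
  let ι : C(Literature.AlgebraicGeometry.Motives.complexPointsCompl X Z,
      Literature.AlgebraicGeometry.Motives.complexPointsCompl X Z') :=
    ⟨fun P ↦ ⟨P.1, fun hP ↦ P.2 (h P.1 hP)⟩, Continuous.subtype_mk continuous_subtype_val _⟩
  have hfac : complexBetti.restrictCompl X Z k =
      complexBetti.restrictCompl X Z' k ≫ singularCohomology.map ℂ ℂ ι k := by
    rw [complexBetti.restrictCompl, complexBetti.restrictCompl, ← singularCohomology.map_comp]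
    rfl
  rw [hfac, ModuleCat.comp_apply, hx, map_zero]

/-- Nested special cycles: for totally positive `W ≤ W'`, `c(W')(ℂ) ⊆ c(W)(ℂ)` (a sub-ball of the sub-ball), hence
`classesSupportedOn X (c(W')) k ≤ classesSupportedOn X (c(W)) k`. -/
theorem classesSupportedOn_specialSubvariety_mono {p : ℕ} {X : SchemeOver ℂ} (D : UnitaryBallQuotientDatum p X)
    {W W' : Submodule D.E (Fin (p + 1) → D.E)} (hW : IsTotallyPositive (conjRingHom D.E) D.H W)
    (hW' : IsTotallyPositive (conjRingHom D.E) D.H W') (hle : W ≤ W') (k : ℕ) :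
    classesSupportedOn X (D.specialSubvariety W') k ≤ classesSupportedOn X (D.specialSubvariety W) k := by
  refine classesSupportedOn_mono_of_complexPoints (fun P hP ↦ ?_) k
  rw [D.pt_mem_specialSubvariety_iff W' hW' P] at hP
  rw [D.pt_mem_specialSubvariety_iff W hW P]
  obtain ⟨v, ⟨hv, horth⟩, rfl⟩ := hP
  refine ⟨v, ⟨hv, fun w hw ↦ horth w ?_⟩, rfl⟩
  obtain ⟨w₀, hw₀, rfl⟩ := hw
  exact ⟨w₀, hle hw₀, rfl⟩

end Summit.HodgeConjecture.HodgeConjecture.Cruxes.BallQuotientHodgeAbsolute.GgpStaircaseSpecialLevel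

end
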